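import Summits.QuantumFields.BalabanUV.T4Continuum.Support.ShellMeasureWilsonGradientTail

/-!
# `T4Continuum.ShellMeasureWilsonGradientTailScaled` — (P4) ONE-GRID FACE IN THE PRINTED CURRENCY, letter (a): the
# `η`-SCALED display (97) at `j = 0` — pure scaling bookkeeping over the owner's `ShellMeasureLocalGradientTail`
(cell `pub-balaban`, sub-cell `t4`, spine estimate NE7c (node U5b); NE7c ROUND-2 crew `t4-ne7c-formalise-*`, unit
`b2b-balaban-t4-ne7c-formalise-leaf-01` gen 5; owner table `t4/b2b-balaban-t4-ne7c-p1/LEAVES-NE7c-P1.md` v2.7 row **S63 (a)**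
(journal `CLAIMS.log` «CLAIM NE7c-S63 (a)»); ADDITIVE — imports the owner's S62 f2 `ShellMeasureWilsonGradientTail` (p220909; hence f1
`ShellMeasureLocalGradientTail` p220699) ONLY,
modifies nothing; [folklore] elementary calculus on complex normed spaces; 0 `def`, 0 `def … : Prop`, 0 sorry, 0 citation tags)

HONEST FRAMING.  Finite four-torus programme, rung (B)+1 only — NOT infinite volume, NOT a mass gap, NOT the Clay
problem, NOT summit progress; (B), `BetaPertHyp`, (B^μ) are not consumed.  NE7c (`T4IndicatorShell.ShellWeightBound`) is
NOT PRINTED and NOT PROVED; «NE7c ⇐ the named binders».  Nothing of [Balaban1985Variational] is asserted: the display (97)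
«`|((δ∕δA′)V)(A′)| < C₄ε₃²(Lʲη)⁻³` on `Ω_j`» (Prop. 4, pp. 292–293; render `b2b-balaban-ref1/pages/1985-cmp102-variational-
background/…-p017-x2.png`, READ AS AN IMAGE) is a LOCATOR for the SHAPE reproduced here at ONE GRID (`j = 0`, `Lʲη = η`) —
and only for an ABSTRACT one-grid functional `𝒲` whose bond-localised gradient 2-tail already has the (98) shape
`Prop4Hyp (tail₂ (locGrad 𝒲)) C₄ a₃` (the owner's `prop4Hyp_locGrad` supplies it for sums of local analytic plaquette
functionals; his S62 f2 `prop4Hyp_wilsonV` for the Wilson plaquette functional).  The multi-scale statement on `Ω_j`,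
`j ≥ 1` (row S65), the `HD`-terms (row S66), the commutator terms (91)–(96) and the identification with Bałaban's sectioned
`V` ([dict]) are NOT here.  HONEST DEPENDENCY (cell, verbatim): continuum YM on T⁴ ⇐ BetaPertH ∧ nine spine estimates (0/9
proved); BetaPertH ⇐ (D1) ∧ (D4) ∧ CAP+tail; G-an2-4 gates asym, D1 and NE2/3/4.

THE POINT.  B11's one-grid objects live on the `η`-lattice: the bond variables are `U₁ = exp(iηA′)`, the action carries the
weight `η^{d−4}`, and functional derivatives are read through the pairing `⟨A′, B′⟩_η = ηᵈ Σ_b ⟨A′(b), B′(b)⟩`.  So the printed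
functional on the `η`-lattice is `V_η(A′) := η^{d−4} · 𝒲(η • A′)` for a UNIT-lattice functional `𝒲` (S62's currency, `A =
ηA′`), and the printed bond-local functional derivative is `η^{−d} • locGrad V_η A′` (S62 f1's `locGrad` divided by the
pairing weight `ηᵈ`).  This file proves the three scaling identities the row asks for and reads off (97) at `j = 0`:
* §1 `fderiv_comp_smul_zero`, **`tail₂_comp_smul`** (`tail₂ (G ∘ (c • ·)) = (tail₂ G) ∘ (c • ·)`), `tail₂_const_smul`,
  `tail₂_smul_comp_smul` — for `G` differentiable at `0`, any scalar `c`, `k : ℂ`;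
* §2 **`locGrad_smul_comp_smul`** (`locGrad (k • (V ∘ (c • ·))) A b = (k·c) • locGrad V (c • A) b`, `V` differentiable at
  `c • A`) and its eventual form near `0` on the ball where `𝒲` is analytic;
* §3 **`tail₂_locGrad_scaled`**: for `𝒲` analytic on `ball 0 R`, `0 < η`, `‖η • A′‖ < R`:
  `η^{−d} • tail₂ (locGrad V_η) A′ = η^{−3} • tail₂ (locGrad 𝒲) (η • A′)` — the powers of `η` displayed:
  `η^{−d} · η^{d−4} · η = η^{−3}` (`zpow_scaling`; at `d = 4` the action weight is `1`, `tail₂_locGrad_scaled_four`);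
  **`norm_tail₂_locGrad_scaled_le`**: if moreover `Prop4Hyp (tail₂ (locGrad 𝒲)) C₄ a₃` with `0 ≤ C₄`, `a₃ ≤ R`, then for
  `‖A′‖_sup < ε₃·η⁻¹`, `ε₃ ≤ a₃`: `‖η^{−d} • tail₂ (locGrad V_η) A′‖_sup ≤ C₄·ε₃²·η^{−3}` — LITERALLY the shape of (97) at `j = 0`;
* §4 **`norm_tail₂_locGrad_sum_scaled_le`**: §3 fed by the owner's `prop4Hyp_locGrad` for `𝒲 = Σ_{p ∈ Pl} φ_p` (local analytic
  plaquette functionals bounded by `M₀` on `ball 0 R`, incidence `≤ m`): `C₄ = 32·m·M₀∕R³`, `a₃ = R∕2` — constants VOLUME-FREE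
  and `η`-free;
* §5 **`norm_tail₂_locGrad_wilsonV_scaled_le`** (+ `_one` at `R = 1`): §3 fed by the owner's S62 f2 `prop4Hyp_wilsonV` — the
  ONE-GRID WILSON-TYPE ACTION `𝒲(A) = Σ_p τ(1 − (e^{iA}U₀)(∂p))` about ANY background with `‖U₀(b)‖, ‖U₀(b)⁻¹‖ ≤ 1`, read on the
  `η`-lattice as `V_η(A′) = η^{d−4}·𝒲(ηA′)` (`U₁ = exp(iηA′)`): `‖η^{−d} • tail₂ (locGrad V_η) A′‖_sup ≤ (32·m·‖τ‖(1 + e^{4R})∕R³)·ε₃²·η^{−3}`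
  for `‖A′‖_sup < ε₃η⁻¹`, `ε₃ ≤ R∕2` — (97)'s display at `j = 0` with `C₄ = C₄(m, ‖τ‖, R)` and `a₃ = R∕2` explicit.  Letter (b) of the
  row (the `M_N(ℂ)` ∕ `SU(N)` instance, `m = 2(d−1)`, `‖τ‖`) is leaf-09's separate file.
-/

noncomputable section

open Metric Set Filter
open scoped Topology

namespace Summit.QuantumFields.BalabanUV.T4Continuum.ShellMeasureWilsonGradientTailScaled

open Literature.MathematicalPhysics.QuantumFieldTheory.Balaban1983to89
open B11Prop6Scheme (Prop4Hyp)
open ShellMeasureLocalGradientTail (tail₂ tail₂_apply tail₂_congr sgl sgl_apply locGrad locGrad_apply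
  differentiableOn_locGrad prop4Hyp_locGrad analyticOnNhd_sum)
open ShellMeasureWilsonGradientTail (plaqFun bonds wilsonV analyticAt_plaqFun prop4Hyp_wilsonV)

variable {E F : Type*} [NormedAddCommGroup E] [NormedSpace ℂ E] [NormedAddCommGroup F] [NormedSpace ℂ F]

/-! ## §1 Scaling of the 2-tail -/

/-- Chain rule at the origin for a dilation: `D(G ∘ (c • ·))(0) = c • DG(0)` (`G` differentiable at `0`). [folklore] -/
theorem fderiv_comp_smul_zero (G : E → F) (c : ℂ) (hG : DifferentiableAt ℂ G 0) :
    fderiv ℂ (fun x => G (c • x)) 0 = c • fderiv ℂ G 0 := by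
  have hin : HasFDerivAt (fun x : E => c • x) (c • ContinuousLinearMap.id ℂ E) 0 :=
    (ContinuousLinearMap.id ℂ E).hasFDerivAt.const_smul c
  have hG' : HasFDerivAt G (fderiv ℂ G 0) ((fun x : E => c • x) 0) := by
    simp only [smul_zero]
    exact hG.hasFDerivAt
  have h : HasFDerivAt (fun x : E => G (c • x)) ((fderiv ℂ G 0).comp (c • ContinuousLinearMap.id ℂ E)) 0 :=
    hG'.comp (0 : E) hin
  rw [h.fderiv]
  ext x
  simp only [ContinuousLinearMap.coe_comp, Function.comp_apply, smul_apply,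
    ContinuousLinearMap.coe_id', id_eq, map_smul]

/-- **THE 2-TAIL COMMUTES WITH DILATIONS**: `tail₂ (G ∘ (c • ·)) = (tail₂ G) ∘ (c • ·)` for `G` differentiable at `0`
(B11's passage between the `η`-lattice variable `A′` and the unit variable `A = ηA′`). [folklore] -/
theorem tail₂_comp_smul (G : E → F) (c : ℂ) (hG : DifferentiableAt ℂ G 0) :
    tail₂ (fun x => G (c • x)) = fun x => tail₂ G (c • x) := by
  funext x
  rw [tail₂_apply, tail₂_apply, fderiv_comp_smul_zero G c hG, smul_zero, smul_apply,
    ← (fderiv ℂ G 0).map_smul c x]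

/-- The 2-tail is linear in the map: `tail₂ (k • G) = k • tail₂ G` (`G` differentiable at `0`). [folklore] -/
theorem tail₂_const_smul (G : E → F) (k : ℂ) (hG : DifferentiableAt ℂ G 0) :
    tail₂ (fun x => k • G x) = fun x => k • tail₂ G x := by
  have h : HasFDerivAt (fun y : E => k • G y) (k • fderiv ℂ G 0) 0 := hG.hasFDerivAt.const_smul k
  funext x
  rw [tail₂_apply, tail₂_apply, h.fderiv, smul_apply, smul_sub, smul_sub]

/-- Both at once: `tail₂ (x ↦ k • G (c • x)) = x ↦ k • tail₂ G (c • x)`. [folklore] -/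
theorem tail₂_smul_comp_smul (G : E → F) (k c : ℂ) (hG : DifferentiableAt ℂ G 0) :
    tail₂ (fun x => k • G (c • x)) = fun x => k • tail₂ G (c • x) := by
  have h1 : DifferentiableAt ℂ (fun x : E => G (c • x)) 0 := by
    have : DifferentiableAt ℂ G (c • (0 : E)) := by rwa [smul_zero]
    exact this.comp 0 (differentiableAt_id.const_smul c)
  rw [tail₂_const_smul (fun x => G (c • x)) k h1, tail₂_comp_smul G c hG]

/-! ## §2 Scaling of the bond-localised derivative -/

section Bonds

variable {Λ : Type*} [Fintype Λ] [DecidableEq Λ] {𝔄 : Type*} [NormedAddCommGroup 𝔄] [NormedSpace ℂ 𝔄]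

/-- **THE BOND-LOCAL DERIVATIVE OF A RESCALED FUNCTIONAL**: for `V` differentiable at `c • A`,
`locGrad (A ↦ k • V (c • A)) A b = (k·c) • locGrad V (c • A) b` — with `k = η^{d−4}`, `c = η` this is the one-grid
functional `V_η(A′) = η^{d−4}·𝒲(ηA′)` of the `η`-lattice. [folklore] -/
theorem locGrad_smul_comp_smul (V : (Λ → 𝔄) → ℂ) (k c : ℂ) (A : Λ → 𝔄) (hV : DifferentiableAt ℂ V (c • A)) (b : Λ) :
    locGrad (fun A => k • V (c • A)) A b = (k * c) • locGrad V (c • A) b := by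
  have hin : HasFDerivAt (fun x : Λ → 𝔄 => c • x) (c • ContinuousLinearMap.id ℂ (Λ → 𝔄)) A :=
    (ContinuousLinearMap.id ℂ (Λ → 𝔄)).hasFDerivAt.const_smul c
  have h : HasFDerivAt (fun A : Λ → 𝔄 => k • V (c • A))
      (k • ((fderiv ℂ V (c • A)).comp (c • ContinuousLinearMap.id ℂ (Λ → 𝔄)))) A :=
    (hV.hasFDerivAt.comp A hin).const_smul k
  rw [locGrad_apply, locGrad_apply, h.fderiv]
  ext X
  simp only [ContinuousLinearMap.coe_comp, Function.comp_apply, smul_apply,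
    ContinuousLinearMap.coe_id', id_eq, map_smul, smul_smul]

/-- … as an identity of bond-indexed families (all bonds at once). [folklore] -/
theorem locGrad_smul_comp_smul_eq (V : (Λ → 𝔄) → ℂ) (k c : ℂ) (A : Λ → 𝔄) (hV : DifferentiableAt ℂ V (c • A)) :
    locGrad (fun A => k • V (c • A)) A = (k * c) • locGrad V (c • A) := by
  funext b
  rw [Pi.smul_apply, locGrad_smul_comp_smul V k c A hV b]

/-- Near the origin (and wherever `‖c • A‖ < R`), for `𝒲` differentiable on `ball 0 R`, the rescaled functional's bond-local
derivative IS the rescaled bond-local derivative: an eventual equality at `0` (the set `{‖c • A‖ < R}` is a neighbourhood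
of `0`). [folklore] -/
theorem locGrad_scaled_eventuallyEq {𝒲 : (Λ → 𝔄) → ℂ} {R : ℝ} (hR : 0 < R) (h𝒲 : DifferentiableOn ℂ 𝒲 (ball 0 R))
    (k c : ℂ) :
    (fun A => locGrad (fun A => k • 𝒲 (c • A)) A) =ᶠ[𝓝 0] fun A => (k * c) • locGrad 𝒲 (c • A) := by
  have hopen : IsOpen {A : Λ → 𝔄 | ‖c • A‖ < R} :=
    isOpen_lt (continuous_const_smul c).norm continuous_const
  have h0 : (0 : Λ → 𝔄) ∈ {A : Λ → 𝔄 | ‖c • A‖ < R} := by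
    simp only [mem_setOf_eq, smul_zero, norm_zero]
    exact hR
  refine Filter.eventuallyEq_of_mem (hopen.mem_nhds h0) fun A hA => ?_
  exact locGrad_smul_comp_smul_eq 𝒲 k c A
    ((h𝒲 (c • A) (mem_ball_zero_iff.2 hA)).differentiableAt (isOpen_ball.mem_nhds (mem_ball_zero_iff.2 hA)))

end Bonds

/-! ## §3 The display (97) at one grid: `η^{−d} • tail₂ (locGrad V_η) A′ = η^{−3} • tail₂ (locGrad 𝒲) (ηA′)` -/

/-- THE POWERS OF `η`: `η^{−d} · (η^{d−4} · η) = η^{−3}` (`0 < η`; the pairing weight `ηᵈ`, the action weight `η^{d−4}`,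
one `η` from the chain rule). [folklore] -/
theorem zpow_scaling {η : ℝ} (hη : 0 < η) (d : ℕ) :
    η ^ (-(d : ℤ)) * (η ^ ((d : ℤ) - 4) * η) = η ^ (-3 : ℤ) := by
  have hη0 : η ≠ 0 := hη.ne'
  rw [← zpow_add_one₀ hη0, ← zpow_add₀ hη0]
  congr 1
  ring

section Scaled

variable {Λ : Type*} [Fintype Λ] [DecidableEq Λ] {𝔄 : Type*} [NormedAddCommGroup 𝔄] [NormedSpace ℂ 𝔄]

/-- **(97)'s SCALING IDENTITY AT ONE GRID.**  For a unit-lattice functional `𝒲` analytic on `ball 0 R`, `0 < η`, and an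
`η`-lattice configuration `A′` with `‖η • A′‖ < R`: the printed bond-local derivative's 2-tail of the `η`-lattice functional
`V_η(A′) := η^{d−4} · 𝒲(η • A′)`, read through the pairing weight `ηᵈ`, is `η^{−3}` times the unit-lattice tail at `ηA′`:
`η^{−d} • tail₂ (locGrad V_η) A′ = η^{−3} • tail₂ (locGrad 𝒲) (η • A′)`. [folklore] -/
theorem tail₂_locGrad_scaled {𝒲 : (Λ → 𝔄) → ℂ} {R : ℝ} (hR : 0 < R) (h𝒲 : AnalyticOnNhd ℂ 𝒲 (ball 0 R))
    {η : ℝ} (hη : 0 < η) (d : ℕ) {A' : Λ → 𝔄} (hA : ‖(η : ℂ) • A'‖ < R) :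
    ((η ^ (-(d : ℤ)) : ℝ) : ℂ) • tail₂ (locGrad (fun A => ((η ^ ((d : ℤ) - 4) : ℝ) : ℂ) • 𝒲 ((η : ℂ) • A))) A' =
      ((η ^ (-3 : ℤ) : ℝ) : ℂ) • tail₂ (locGrad 𝒲) ((η : ℂ) • A') := by
  -- the rescaled functional's `locGrad` is the rescaled `locGrad`, near `0` and at `A'`
  have hev := locGrad_scaled_eventuallyEq hR h𝒲.differentiableOn (((η ^ ((d : ℤ) - 4) : ℝ) : ℂ)) (η : ℂ)
  have hat : locGrad (fun A => ((η ^ ((d : ℤ) - 4) : ℝ) : ℂ) • 𝒲 ((η : ℂ) • A)) A' =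
      ((((η ^ ((d : ℤ) - 4) : ℝ) : ℂ)) * (η : ℂ)) • locGrad 𝒲 ((η : ℂ) • A') :=
    locGrad_smul_comp_smul_eq 𝒲 _ _ A'
      ((h𝒲 _ (mem_ball_zero_iff.2 hA)).differentiableAt)
  rw [tail₂_congr hev hat]
  -- `locGrad 𝒲` is differentiable at `0`
  have hG0 : DifferentiableAt ℂ (locGrad 𝒲) 0 :=
    (differentiableOn_locGrad h𝒲 0 (mem_ball_self hR)).differentiableAt (isOpen_ball.mem_nhds (mem_ball_self hR))
  rw [tail₂_smul_comp_smul (locGrad 𝒲) _ (η : ℂ) hG0]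
  -- collect the powers of `η`
  rw [smul_smul, ← Complex.ofReal_mul, ← Complex.ofReal_mul, zpow_scaling hη d]

/-- … at `d = 4` the action weight is `η⁰ = 1`: `η^{−4} • tail₂ (locGrad (A′ ↦ 𝒲(ηA′))) A′ = η^{−3} • tail₂ (locGrad 𝒲) (ηA′)`.
[folklore] -/
theorem tail₂_locGrad_scaled_four {𝒲 : (Λ → 𝔄) → ℂ} {R : ℝ} (hR : 0 < R) (h𝒲 : AnalyticOnNhd ℂ 𝒲 (ball 0 R))
    {η : ℝ} (hη : 0 < η) {A' : Λ → 𝔄} (hA : ‖(η : ℂ) • A'‖ < R) :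
    ((η ^ (-4 : ℤ) : ℝ) : ℂ) • tail₂ (locGrad (fun A => 𝒲 ((η : ℂ) • A))) A' =
      ((η ^ (-3 : ℤ) : ℝ) : ℂ) • tail₂ (locGrad 𝒲) ((η : ℂ) • A') := by
  have h := tail₂_locGrad_scaled hR h𝒲 hη 4 hA
  simp only [Nat.cast_ofNat, sub_self, zpow_zero, Complex.ofReal_one, one_smul] at h
  exact h

/-- **THE (97) SHAPE AT `j = 0`, IN THE PRINTED CURRENCY.**  If the unit-lattice functional `𝒲` is analytic on `ball 0 R`
and its bond-local gradient 2-tail has the (98) shape `Prop4Hyp (tail₂ (locGrad 𝒲)) C₄ a₃` (`0 ≤ C₄`, `a₃ ≤ R`), then for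
`0 < η`, `ε₃ ≤ a₃` and every `η`-lattice configuration with `‖A′‖_sup < ε₃·η⁻¹`:
`‖η^{−d} • tail₂ (locGrad V_η) A′‖_sup ≤ C₄ · ε₃² · η^{−3}`, `V_η(A′) = η^{d−4}·𝒲(ηA′)` — the display
«`|((δ∕δA′)V)(A′)| < C₄ε₃²(Lʲη)⁻³` on `Ω_j`» at `j = 0` for the order-≥3 part of a one-grid functional (LOCATOR only; nothing
printed is asserted). [folklore] -/
theorem norm_tail₂_locGrad_scaled_le {𝒲 : (Λ → 𝔄) → ℂ} {R C₄ a₃ : ℝ} (hR : 0 < R)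
    (h𝒲 : AnalyticOnNhd ℂ 𝒲 (ball 0 R)) (hP : Prop4Hyp (tail₂ (locGrad 𝒲)) C₄ a₃) (hC₄ : 0 ≤ C₄) (ha : a₃ ≤ R)
    {η : ℝ} (hη : 0 < η) (d : ℕ) {ε₃ : ℝ} (hε : ε₃ ≤ a₃) {A' : Λ → 𝔄} (hA : ‖A'‖ < ε₃ * η⁻¹) :
    ‖((η ^ (-(d : ℤ)) : ℝ) : ℂ) • tail₂ (locGrad (fun A => ((η ^ ((d : ℤ) - 4) : ℝ) : ℂ) • 𝒲 ((η : ℂ) • A))) A'‖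
      ≤ C₄ * ε₃ ^ 2 * η ^ (-3 : ℤ) := by
  have hnorm : ‖(η : ℂ) • A'‖ = η * ‖A'‖ := by
    rw [norm_smul, Complex.norm_real, Real.norm_of_nonneg hη.le]
  have hlt : ‖(η : ℂ) • A'‖ < ε₃ := by
    rw [hnorm]
    calc η * ‖A'‖ < η * (ε₃ * η⁻¹) := mul_lt_mul_of_pos_left hA hη
      _ = ε₃ := by field_simp
  have hR' : ‖(η : ℂ) • A'‖ < R := lt_of_lt_of_le hlt (hε.trans ha)
  rw [tail₂_locGrad_scaled hR h𝒲 hη d hR', norm_smul, Complex.norm_real, Real.norm_of_nonneg (zpow_nonneg hη.le _)]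
  have hq := hP.quad ((η : ℂ) • A') (lt_of_lt_of_le hlt hε)
  have hsq : ‖(η : ℂ) • A'‖ ^ 2 ≤ ε₃ ^ 2 := by
    have h0 : 0 ≤ ‖(η : ℂ) • A'‖ := norm_nonneg _
    nlinarith
  calc η ^ (-3 : ℤ) * ‖tail₂ (locGrad 𝒲) ((η : ℂ) • A')‖ ≤ η ^ (-3 : ℤ) * (C₄ * ε₃ ^ 2) := by
        refine mul_le_mul_of_nonneg_left (hq.trans ?_) (zpow_nonneg hη.le _)
        exact mul_le_mul_of_nonneg_left hsq hC₄
    _ = C₄ * ε₃ ^ 2 * η ^ (-3 : ℤ) := by ring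

end Scaled

/-! ## §4 Local sums of plaquette functionals: the owner's `prop4Hyp_locGrad` plugged in -/

section LocalSum

variable {Λ : Type*} [Fintype Λ] [DecidableEq Λ] {𝔄 : Type*} [NormedAddCommGroup 𝔄] [NormedSpace ℂ 𝔄]
  {P : Type*} (Pl : Finset P) (φ : P → (Λ → 𝔄) → ℂ) (supp : P → Finset Λ)

/-- **THE (97) SHAPE AT `j = 0` FOR A SUM OF LOCAL ANALYTIC PLAQUETTE FUNCTIONALS** `𝒲 = Σ_{p ∈ Pl} φ_p` (each analytic and
bounded by `M₀ ≥ 0` on `ball 0 R`, blind to the bonds off `supp p`; at most `m` plaquettes through any bond): with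
`C₄ := 32·m·M₀∕R³`, `a₃ := R∕2` (the owner's `prop4Hyp_locGrad`), for `0 < η`, `ε₃ ≤ R∕2`, `‖A′‖_sup < ε₃·η⁻¹`:
`‖η^{−d} • tail₂ (locGrad V_η) A′‖_sup ≤ (32·m·M₀∕R³)·ε₃²·η^{−3}` — VOLUME-FREE and with the powers of `η` displayed.
[folklore] -/
theorem norm_tail₂_locGrad_sum_scaled_le {R M₀ : ℝ} {m : ℕ} (hR : 0 < R) (hM₀ : 0 ≤ M₀)
    (ha : ∀ p ∈ Pl, AnalyticOnNhd ℂ (φ p) (ball 0 R))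
    (hM : ∀ p ∈ Pl, ∀ A ∈ ball (0 : Λ → 𝔄) R, ‖φ p A‖ ≤ M₀)
    (hloc : ∀ p ∈ Pl, ∀ A : Λ → 𝔄, ∀ b ∉ supp p, ∀ X : 𝔄, φ p (A + Pi.single b X) = φ p A)
    (hm : ∀ b : Λ, (Pl.filter (fun p => b ∈ supp p)).card ≤ m)
    {η : ℝ} (hη : 0 < η) (d : ℕ) {ε₃ : ℝ} (hε : ε₃ ≤ R / 2) {A' : Λ → 𝔄} (hA : ‖A'‖ < ε₃ * η⁻¹) :
    ‖((η ^ (-(d : ℤ)) : ℝ) : ℂ) •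
        tail₂ (locGrad (fun A => ((η ^ ((d : ℤ) - 4) : ℝ) : ℂ) • ∑ p ∈ Pl, φ p ((η : ℂ) • A))) A'‖
      ≤ 32 * m * M₀ / R ^ 3 * ε₃ ^ 2 * η ^ (-3 : ℤ) :=
  norm_tail₂_locGrad_scaled_le (𝒲 := fun A => ∑ p ∈ Pl, φ p A) hR (analyticOnNhd_sum Pl φ ha)
    (prop4Hyp_locGrad Pl φ supp hR hM₀ ha hM hloc hm) (by positivity) (by linarith) hη d hε hA

end LocalSum

/-! ## §5 The one-grid Wilson-type action on the `η`-lattice: (97) at `j = 0` with every constant explicit -/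

section Wilson

variable {Λ : Type*} [Fintype Λ] [DecidableEq Λ] {𝔸 : Type*} [NormedRing 𝔸] [NormedAlgebra ℂ 𝔸] [CompleteSpace 𝔸]
  [NormOneClass 𝔸] {P : Type*} (Pl : Finset P) (bd : P → Fin 4 → Λ × Bool) (τ : 𝔸 →L[ℂ] ℂ) (U : Λ → 𝔸ˣ)

omit [DecidableEq Λ] in
/-- The one-grid Wilson-type action is analytic on every ball (it is entire: `analyticAt_plaqFun` summed). [folklore] -/
theorem analyticOnNhd_wilsonV (hU : ∀ b, ‖(U b : 𝔸)‖ ≤ 1) (hU' : ∀ b, ‖(((U b)⁻¹ : 𝔸ˣ) : 𝔸)‖ ≤ 1) (R : ℝ) :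
    AnalyticOnNhd ℂ (wilsonV Pl bd τ U) (ball 0 R) := by
  show AnalyticOnNhd ℂ (fun A => ∑ p ∈ Pl, plaqFun τ U (bd p) A) (ball 0 R)
  exact analyticOnNhd_sum Pl (fun p => plaqFun τ U (bd p)) fun p _ A _ => analyticAt_plaqFun hU hU' τ (bd p) A

/-- **[B11] (97) AT `j = 0` IN THE PRINTED CURRENCY, FOR THE WILSON-TYPE ONE-GRID ACTION.**  For ANY background with
`‖U₀(b)‖, ‖U₀(b)⁻¹‖ ≤ 1` (e.g. unitary), ANY finite plaquette family with at most `m` plaquettes through a bond, ANY `R > 0` and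
lattice spacing `η > 0`: the `η`-lattice functional `V_η(A′) := η^{d−4}·𝒲(ηA′)`, `𝒲(A) = Σ_p τ(1 − (e^{iA}U₀)(∂p))`, has, read
through the pairing weight `ηᵈ`, the bond-local gradient 2-tail bounded by
`‖η^{−d} • tail₂ (locGrad V_η) A′‖_sup ≤ (32·m·‖τ‖(1 + e^{4R})∕R³)·ε₃²·η^{−3}` for `‖A′‖_sup < ε₃η⁻¹`, `ε₃ ≤ R∕2` — the display
«`|((δ∕δA′)V)(A′)| < C₄ε₃²(Lʲη)⁻³` on `Ω_j`» at `j = 0`, with `C₄ = C₄(m, ‖τ‖, R)` and `a₃ = R∕2` EXPLICIT, volume-free,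
background-free.  (LOCATOR only; the multi-scale `j ≥ 1` statement, the `HD`-terms and the [dict] are NOT here.) [folklore] -/
theorem norm_tail₂_locGrad_wilsonV_scaled_le (hU : ∀ b, ‖(U b : 𝔸)‖ ≤ 1) (hU' : ∀ b, ‖(((U b)⁻¹ : 𝔸ˣ) : 𝔸)‖ ≤ 1)
    {m : ℕ} (hm : ∀ b : Λ, (Pl.filter (fun p => b ∈ bonds (bd p))).card ≤ m) {R : ℝ} (hR : 0 < R)
    {η : ℝ} (hη : 0 < η) (d : ℕ) {ε₃ : ℝ} (hε : ε₃ ≤ R / 2) {A' : Λ → 𝔸} (hA : ‖A'‖ < ε₃ * η⁻¹) :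
    ‖((η ^ (-(d : ℤ)) : ℝ) : ℂ) •
        tail₂ (locGrad (fun A => ((η ^ ((d : ℤ) - 4) : ℝ) : ℂ) • wilsonV Pl bd τ U ((η : ℂ) • A))) A'‖
      ≤ 32 * m * (‖τ‖ * (1 + Real.exp (4 * R))) / R ^ 3 * ε₃ ^ 2 * η ^ (-3 : ℤ) :=
  norm_tail₂_locGrad_scaled_le hR (analyticOnNhd_wilsonV Pl bd τ U hU hU' R) (prop4Hyp_wilsonV Pl bd τ U hU hU' hm hR)
    (by positivity) (by linarith) hη d hε hA

/-- … at the fixed unit radius `R = 1`: `C₄ = 32·m·‖τ‖·(1 + e⁴)`, `a₃ = 1∕2` — numbers made of `m` and `‖τ‖` alone; for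
`‖A′‖_sup < ε₃η⁻¹`, `ε₃ ≤ 1∕2`: `‖η^{−d} • tail₂ (locGrad V_η) A′‖_sup ≤ 32·m·‖τ‖(1 + e⁴)·ε₃²·η^{−3}`. [folklore] -/
theorem norm_tail₂_locGrad_wilsonV_scaled_le_one (hU : ∀ b, ‖(U b : 𝔸)‖ ≤ 1) (hU' : ∀ b, ‖(((U b)⁻¹ : 𝔸ˣ) : 𝔸)‖ ≤ 1)
    {m : ℕ} (hm : ∀ b : Λ, (Pl.filter (fun p => b ∈ bonds (bd p))).card ≤ m)
    {η : ℝ} (hη : 0 < η) (d : ℕ) {ε₃ : ℝ} (hε : ε₃ ≤ 1 / 2) {A' : Λ → 𝔸} (hA : ‖A'‖ < ε₃ * η⁻¹) :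
    ‖((η ^ (-(d : ℤ)) : ℝ) : ℂ) •
        tail₂ (locGrad (fun A => ((η ^ ((d : ℤ) - 4) : ℝ) : ℂ) • wilsonV Pl bd τ U ((η : ℂ) • A))) A'‖
      ≤ 32 * m * (‖τ‖ * (1 + Real.exp 4)) * ε₃ ^ 2 * η ^ (-3 : ℤ) := by
  have h := norm_tail₂_locGrad_wilsonV_scaled_le Pl bd τ U hU hU' hm one_pos hη d hε hA
  simpa only [mul_one, one_pow, div_one] using h

end Wilson

end Summit.QuantumFields.BalabanUV.T4Continuum.ShellMeasureWilsonGradientTailScaled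

end
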